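import Literature.MathematicalPhysics.KineticTheory.ReyBelletThomas2002Reversal
import Literature.MathematicalPhysics.KineticTheory.ReyBelletThomas2002TransitionDensity
import Literature.Analysis.Distribution.BracketGeneratingProd
import HarnessLib

/-!
# Rey-Bellet–Thomas 2002, Theorem 2.1: the transition densities are JOINTLY smooth, `p ∈ C^∞((0,∞) × X × X)`

Trunk T-KINETIC (Literature/MathematicalPhysics/KineticTheory). Inline decomposition step for the
named fact `ReyBelletThomas2002_thm21` (provefact unit): the first clause of Theorem 2.1 — "The
Markov process `x(t)` which solves (12) has smooth transition probability densities,
`P_t(x, dy) = p_t(x, y) dy`, with `p_t(x, y) ∈ C^∞((0, ∞) × X × X)`" — for the CONSTRUCTED transition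
kernels `rbKernel` of (RBT-SDE), from Hörmander's theorem (the named fact
`Literature.Analysis.Distribution.Hormander1967_thm11`) applied on `ℝ × X × X` to the operator

  `P̃ = ∑_b (X_{b,x}² + X_{b,y}²) + (X₀(x)·∇_x - X₀(y)·∇_y - 2∂_t) + 2γ`,    `ᵗP̃ = 2∂_t + L_y + Lᵀ_x`,

whose family is the time lift of the PRODUCT of the generator's family in `x` and of the
Fokker–Planck family in `y` (`BracketGeneratingProd.lean`, `BracketGeneratingLift.lean`; bracket
generating by Prop. 4.1 without the bare drift in each factor, `ReyBelletThomas2002HormanderLift.lean`).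
The joint law `m(dt, dx, dy) = dt dx P_t(x, dy)` on `(0,∞) × X × X` solves `P̃ m = 0` in `𝓓'`:
`⟨m, (∂_t + L_y)Θ⟩ = 0` by the FORWARD equation for each starting point (`rb_forwardEquation`) and
`⟨m, (∂_t + Lᵀ_x)Θ⟩ = 0` by the BACKWARD equation (`rb_backwardEquation`, from the time-reversal
duality of the kernels with respect to Lebesgue measure). Hypoellipticity gives a smooth density
`p` of `m` on `(0,∞) × X × X`; testing against `ψ(t, x) c(y)` and continuity in `(t, x)` of both
sides identifies `P_t(x, ·) = p(t, x, ·) dy` for EVERY `t > 0` and `x`.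

* `OscillatorChain.rbDoubledFamily`, `isBracketGenerating_rbDoubledFamily`,
  `hormanderTranspose_rbDoubled` (`ᵗP̃Θ = 2∂_tΘ + L_y Θ + (L̂_x Θ + 2γΘ)`), with the slice /
  divergence lemmas they need;
* `MarkovSemigroupFor.jointKernel`, `MarkovSemigroupFor.baseMeasure`, `MarkovSemigroupFor.jointLaw`
  (the joint law `m`, locally finite) and `OscillatorChain.integral_jointLaw_eq`
  (`∫ Θ dm = ∫_{(0,∞)×X} ∫ Θ(t,x,y) P_t(x,dy) dt dx`), `integrable_inner_rbKernel`;
* `OscillatorChain.rb_jointLaw_annihilated` (`⟨m, ᵗP̃ Θ⟩ = 0`);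
* `OscillatorChain.continuous_act_rbSemigroup_timeStart` (`(t, x) ↦ P_t c(x)` jointly continuous);
* `OscillatorChain.rb_jointDensity_of_hormander` — **the first clause of Theorem 2.1 for
  `rbKernel`**, from `Hormander1967_thm11`.

## References

* L. Rey-Bellet, L. E. Thomas, Comm. Math. Phys. 225 (2002) 305–329, Thm 2.1, §4 Prop. 4.1
  ("the Markov process has a `C^∞` law … a consequence of Hörmander Theorem [11, 16]").
* L. Hörmander, *Hypoelliptic second order differential equations*, Acta Math. 119 (1967), Thm 1.1.
-/

noncomputable section

open MeasureTheory ProbabilityTheory Filter Topology Set Function VectorField TopologicalSpace Metric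
open scoped NNReal ENNReal ContDiff Distributions BoundedContinuousFunction

namespace Literature.MathematicalPhysics.KineticTheory.HeatConduction

open Literature.Analysis.Distribution Literature.Probability.Process

variable {N : ℕ}

/-! ### Slices of functions on `ℝ × X × X` -/

section Slices

variable {X : Type*} [NormedAddCommGroup X] [NormedSpace ℝ X] {Θ : ℝ × (X × X) → ℝ}

/-- `D_y[H(x,·)](y)·u = DH(x,y)·(0,u)` (second slot of a pair). [folklore] -/
theorem fderiv_sndSlice_apply {H : X × X → ℝ} (hH : Differentiable ℝ H) (x y u : X) :
    fderiv ℝ (fun y' => H (x, y')) y u = fderiv ℝ H (x, y) (0, u) := by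
  have h1 : HasFDerivAt (fun y' : X => ((x, y') : X × X))
      ((0 : X →L[ℝ] X).prod (ContinuousLinearMap.id ℝ X)) y :=
    (hasFDerivAt_const x y).prodMk (hasFDerivAt_id y)
  have h2 : HasFDerivAt (fun y' : X => H (x, y'))
      ((fderiv ℝ H (x, y)).comp ((0 : X →L[ℝ] X).prod (ContinuousLinearMap.id ℝ X))) y :=
    (hH (x, y)).hasFDerivAt.comp y h1
  rw [h2.fderiv]
  simp

/-- **First-order `y`-slice**: `D_y[Θ(t,x,·)](y)·u = DΘ(t,x,y)·(0,(0,u))`. [folklore] -/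
theorem fderiv_ySlice_apply (hΘ : Differentiable ℝ Θ) (t : ℝ) (x y u : X) :
    fderiv ℝ (fun y' => Θ (t, (x, y'))) y u = fderiv ℝ Θ (t, (x, y)) (0, (0, u)) := by
  have hH : Differentiable ℝ (fun p : X × X => Θ (t, p)) :=
    hΘ.comp ((differentiable_const t).prodMk differentiable_id)
  rw [show (fun y' => Θ (t, (x, y'))) = fun y' => (fun p : X × X => Θ (t, p)) (x, y') from rfl,
    fderiv_sndSlice_apply hH x y u, fderiv_spaceSlice_apply hΘ t (x, y) (0, u)]

/-- **First-order `x`-slice**: `D_x[Θ(t,·,y)](x)·u = DΘ(t,x,y)·(0,(u,0))`. [folklore] -/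
theorem fderiv_xSlice_apply (hΘ : Differentiable ℝ Θ) (t : ℝ) (x y u : X) :
    fderiv ℝ (fun x' => Θ (t, (x', y))) x u = fderiv ℝ Θ (t, (x, y)) (0, (u, 0)) := by
  have hH : Differentiable ℝ (fun p : X × X => Θ (t, p)) :=
    hΘ.comp ((differentiable_const t).prodMk differentiable_id)
  rw [show (fun x' => Θ (t, (x', y))) = fun x' => (fun p : X × X => Θ (t, p)) (x', y) from rfl,
    fderiv_fstSlice_apply hH x y u, fderiv_spaceSlice_apply hΘ t (x, y) (u, 0)]

/-- **Second-order `y`-slice** along a constant direction: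
`D_y[y' ↦ D_y[Θ(t,x,·)](y')·u](y)·u = D[w ↦ DΘ(w)·(0,(0,u))](t,x,y)·(0,(0,u))`. [folklore] -/
theorem fderiv_fderiv_ySlice_apply (hΘ : ContDiff ℝ 2 Θ) (t : ℝ) (x y u : X) :
    fderiv ℝ (fun y' => fderiv ℝ (fun y'' => Θ (t, (x, y''))) y' u) y u =
      fderiv ℝ (fun w : ℝ × (X × X) => fderiv ℝ Θ w (0, (0, u))) (t, (x, y)) (0, (0, u)) := by
  have hd : Differentiable ℝ Θ := hΘ.differentiable (by norm_num)
  have hG : Differentiable ℝ (fun w : ℝ × (X × X) => fderiv ℝ Θ w (0, (0, u))) :=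
    ((hΘ.fderiv_right (m := 1) (by norm_num)).clm_apply contDiff_const).differentiable one_ne_zero
  have h1 : (fun y' => fderiv ℝ (fun y'' => Θ (t, (x, y''))) y' u) =
      fun y' => (fun w : ℝ × (X × X) => fderiv ℝ Θ w (0, (0, u))) (t, (x, y')) :=
    funext fun y' => fderiv_ySlice_apply hd t x y' u
  rw [h1, fderiv_ySlice_apply hG t x y u]

/-- **Second-order `x`-slice** along a constant direction:
`D_x[x' ↦ D_x[Θ(t,·,y)](x')·u](x)·u = D[w ↦ DΘ(w)·(0,(u,0))](t,x,y)·(0,(u,0))`. [folklore] -/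
theorem fderiv_fderiv_xSlice_apply (hΘ : ContDiff ℝ 2 Θ) (t : ℝ) (x y u : X) :
    fderiv ℝ (fun x' => fderiv ℝ (fun x'' => Θ (t, (x'', y))) x' u) x u =
      fderiv ℝ (fun w : ℝ × (X × X) => fderiv ℝ Θ w (0, (u, 0))) (t, (x, y)) (0, (u, 0)) := by
  have hd : Differentiable ℝ Θ := hΘ.differentiable (by norm_num)
  have hG : Differentiable ℝ (fun w : ℝ × (X × X) => fderiv ℝ Θ w (0, (u, 0))) :=
    ((hΘ.fderiv_right (m := 1) (by norm_num)).clm_apply contDiff_const).differentiable one_ne_zero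
  have h1 : (fun x' => fderiv ℝ (fun x'' => Θ (t, (x'', y))) x' u) =
      fun x' => (fun w : ℝ × (X × X) => fderiv ℝ Θ w (0, (u, 0))) (t, (x', y)) :=
    funext fun x' => fderiv_xSlice_apply hd t x' y u
  rw [h1, fderiv_xSlice_apply hG t x y u]

variable [FiniteDimensional ℝ X]

/-- The divergence of the product drift is the sum of the divergences. [folklore] -/
theorem fieldDiv_pairField {V W : X → X} {p : X × X} (hV : DifferentiableAt ℝ V p.1)
    (hW : DifferentiableAt ℝ W p.2) : fieldDiv (pairField V W) p = fieldDiv V p.1 + fieldDiv W p.2 := by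
  unfold fieldDiv
  rw [(hasFDerivAt_pairField hV hW).fderiv]
  have e : (((((fderiv ℝ V p.1).comp (ContinuousLinearMap.fst ℝ X X)).prod
      ((fderiv ℝ W p.2).comp (ContinuousLinearMap.snd ℝ X X))) : X × X →L[ℝ] X × X) : X × X →ₗ[ℝ] X × X) =
      LinearMap.prodMap (fderiv ℝ V p.1 : X →ₗ[ℝ] X) (fderiv ℝ W p.2 : X →ₗ[ℝ] X) := by
    refine LinearMap.ext fun q => ?_
    simp
  rw [e, LinearMap.trace_prodMap']

end Slices

namespace OscillatorChain

variable (P : OscillatorChain)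

/-! ### The doubled Hörmander family on `ℝ × X × X` -/

/-- The time components: `-2` on the drift, `0` on the noise fields. [folklore] -/
def rbDoubledTimeCoeff (o : Option (Fin 2 ⊕ Fin 2)) : ℝ := Option.elim o (-2) fun _ => 0

/-- **The family of `P̃ = ∑_b (X_{b,x}² + X_{b,y}²) + (X₀(x)∇_x - X₀(y)∇_y - 2∂_t) + 2γ`** on
`ℝ × X × X`: the time lift (coefficients `rbDoubledTimeCoeff`) of the product of the generator's
family `(X₀, X_L, X_R)` in `x` and the Fokker–Planck family `(-X₀, X_L, X_R)` in `y`.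
[cite: ReyBelletThomas2002, §4] -/
def rbDoubledFamily (Λ : ℝ) (N : ℕ) (T_L T_R : ℝ) :
    Option (Fin 2 ⊕ Fin 2) → ℝ × (RBPhaseSpace N × RBPhaseSpace N) → ℝ × (RBPhaseSpace N × RBPhaseSpace N) :=
  fun o => liftField (rbDoubledTimeCoeff o)
    (prodFamily (P.rbHormanderFamily Λ N T_L T_R) (P.rbAdjointFamily Λ N T_L T_R) o)

/-- The drift of the doubled family: `Z̃₀(t, x, y) = (-2, X₀ x, -X₀ y)`. [folklore] -/
@[simp] theorem rbDoubledFamily_none (Λ : ℝ) (N : ℕ) (T_L T_R : ℝ)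
    (w : ℝ × (RBPhaseSpace N × RBPhaseSpace N)) :
    P.rbDoubledFamily Λ N T_L T_R none w = (-2, (P.rbDrift Λ N w.2.1, -P.rbDrift Λ N w.2.2)) := rfl

/-- The `x`-noise fields of the doubled family: `(0, X_b, 0)`. [folklore] -/
@[simp] theorem rbDoubledFamily_inl (Λ : ℝ) (N : ℕ) (T_L T_R : ℝ) (b : Fin 2)
    (w : ℝ × (RBPhaseSpace N × RBPhaseSpace N)) :
    P.rbDoubledFamily Λ N T_L T_R (some (Sum.inl b)) w = (0, (P.rbBathField T_L T_R b w.2.1, 0)) := rfl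

/-- The `y`-noise fields of the doubled family: `(0, 0, X_b)`. [folklore] -/
@[simp] theorem rbDoubledFamily_inr (Λ : ℝ) (N : ℕ) (T_L T_R : ℝ) (b : Fin 2)
    (w : ℝ × (RBPhaseSpace N × RBPhaseSpace N)) :
    P.rbDoubledFamily Λ N T_L T_R (some (Sum.inr b)) w = (0, (0, P.rbBathField T_L T_R b w.2.2)) := rfl

/-- All fields of the doubled family are smooth (smooth potentials). [folklore] -/
theorem contDiff_rbDoubledFamily (hU : ContDiff ℝ ∞ P.U) (hV : ContDiff ℝ ∞ P.V) (Λ : ℝ) (N : ℕ)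
    (T_L T_R : ℝ) (o : Option (Fin 2 ⊕ Fin 2)) : ContDiff ℝ ∞ (P.rbDoubledFamily Λ N T_L T_R o) := by
  have hX : ∀ o, ContDiff ℝ ∞ (P.rbHormanderFamily Λ N T_L T_R o) := P.contDiff_rbHormanderFamily hU hV Λ N T_L T_R
  have hX' : ∀ o, ContDiff ℝ ∞ (P.rbAdjointFamily Λ N T_L T_R o) := fun o => by
    rw [P.rbAdjointFamily_eq_smul Λ N T_L T_R o]
    exact (hX o).const_smul (Option.elim o (-1 : ℝ) fun _ => 1)
  exact contDiff_liftField _ (contDiff_prodFamily hX hX' o)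

/-- **The bracket condition for `P̃` everywhere on `ℝ × X × X`**, under H2, `Λ ≠ 0`,
`γT_L, γT_R > 0`: Prop. 4.1 without the bare drift in each factor (`x` and `y`), the product
lemma, and the time lift (`Z̃₀` supplies the time direction). [cite: ReyBelletThomas2002, Prop 4.1] -/
theorem isBracketGenerating_rbDoubledFamily (hU : ContDiff ℝ ∞ P.U) (hV : ContDiff ℝ ∞ P.V)
    {Λ : ℝ} {T_L T_R : ℝ} (hV2 : RBNondegenerate P.V) (hΛ : Λ ≠ 0) (hL : 0 < P.γ * T_L)
    (hR : 0 < P.γ * T_R) : IsBracketGenerating (P.rbDoubledFamily Λ N T_L T_R) univ := by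
  have hX : ∀ o, ContDiff ℝ ∞ (P.rbHormanderFamily Λ N T_L T_R o) := P.contDiff_rbHormanderFamily hU hV Λ N T_L T_R
  have hX' : ∀ o, ContDiff ℝ ∞ (P.rbAdjointFamily Λ N T_L T_R o) := fun o => by
    rw [P.rbAdjointFamily_eq_smul Λ N T_L T_R o]
    exact (hX o).const_smul (Option.elim o (-1 : ℝ) fun _ => 1)
  have hZ : ∀ o, ContDiff ℝ ∞ (prodFamily (P.rbHormanderFamily Λ N T_L T_R) (P.rbAdjointFamily Λ N T_L T_R) o) :=
    contDiff_prodFamily hX hX'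
  -- the allowed sets
  set A : Set (Option (Fin 2)) := {o | o ≠ none} with hAdef
  have hA : ∀ b : Fin 2, some b ∈ A := fun b => by simp [hAdef]
  have hAn : none ∉ A := by simp [hAdef]
  have hgen : ∀ p ∈ (univ : Set (RBPhaseSpace N × RBPhaseSpace N)),
      bracketSpanModAt (prodFamily (P.rbHormanderFamily Λ N T_L T_R) (P.rbAdjointFamily Λ N T_L T_R))
        {o | rbDoubledTimeCoeff o = 0} p = ⊤ := by
    rintro ⟨x, y⟩ -
    refine bracketSpanModAt_prodFamily_eq_top hX hX' hAn hAn (fun i => by simp [rbDoubledTimeCoeff])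
      (fun j => by simp [rbDoubledTimeCoeff]) ?_ ?_
    · exact P.bracketSpanModAt_rbHormanderFamily_eq_top hU hV hA hV2 hΛ hL hR x
    · exact P.bracketSpanModAt_rbAdjointFamily_eq_top hU hV hA hV2 hΛ hL hR y
  have h := isBracketGenerating_lift rbDoubledTimeCoeff hZ (s := univ) hgen (i₀ := none)
    (by simp [rbDoubledTimeCoeff])
  rwa [univ_prod_univ] at h

/-! ### The transpose identity `ᵗP̃ Θ = 2∂_tΘ + L_y Θ + (L̂_x Θ + 2γ Θ)` -/

/-- **The reversed generator in Hörmander form**: `L̂ h = ∑_b X_b(X_b h) - X₀ h` on `C^∞`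
functions (`L = ∑_b X_b X_b + X₀` with the drift's sign flipped). [cite: ReyBelletThomas2002, §2 eq. (13)] -/
theorem sdeGenerator_neg_rbDrift_eq (Λ : ℝ) {T_L T_R : ℝ} (hL : 0 ≤ P.γ * T_L) (hR : 0 ≤ P.γ * T_R)
    {h : RBPhaseSpace N → ℝ} (hh : ContDiff ℝ ∞ h) (x : RBPhaseSpace N) :
    sdeGenerator (fun y => -P.rbDrift Λ N y) (P.rbNoiseVec N T_L T_R 0) (P.rbNoiseVec N T_L T_R 1) h x =
      (∑ b : Fin 2, fieldDeriv (P.rbBathField (N := N) T_L T_R b)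
          (fieldDeriv (P.rbBathField (N := N) T_L T_R b) h) x) - fderiv ℝ h x (P.rbDrift Λ N x) := by
  have h1 : sdeGenerator (fun y => -P.rbDrift Λ N y) (P.rbNoiseVec N T_L T_R 0) (P.rbNoiseVec N T_L T_R 1) h x =
      sdeGenerator (P.rbDrift Λ N) (P.rbNoiseVec N T_L T_R 0) (P.rbNoiseVec N T_L T_R 1) h x -
        2 * fderiv ℝ h x (P.rbDrift Λ N x) := by
    rw [sdeGenerator_def, sdeGenerator_def, map_neg]
    ring
  rw [h1, ← P.rbGenerator_eq_sdeGenerator Λ hL hR (hh.of_le (by norm_cast)) x,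
    P.rbGenerator_eq_hormanderOp Λ hL hR hh x, hormanderOp, fieldDeriv]
  simp only [zero_mul, add_zero]
  ring

/-- **`ᵗP̃ Θ = 2∂_tΘ + L_y Θ + (L̂_x Θ + 2γ Θ)`** for the doubled family (`Z̃_{b,x}, Z̃_{b,y}`
constant, `Z̃₀ = (-2, X₀(x), -X₀(y))` of divergence `div X₀ - div X₀ = 0`), smooth potentials,
`γT_b ≥ 0`, `Θ ∈ C^∞(ℝ × X × X)`: the `y`-terms are the generator `L` of RBT eq. (13) on the slice
`Θ(t, x, ·)`, the `x`-terms are the reversed generator `L̂` on the slice `Θ(t, ·, y)` plus `2γΘ`,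
i.e. the formal transpose `Lᵀ` of `L` acting on `x`. [cite: ReyBelletThomas2002, §4] -/
theorem hormanderTranspose_rbDoubled (hU : ContDiff ℝ ∞ P.U) (hV : ContDiff ℝ ∞ P.V) (Λ : ℝ)
    {T_L T_R : ℝ} (hL : 0 ≤ P.γ * T_L) (hR : 0 ≤ P.γ * T_R)
    {Θ : ℝ × (RBPhaseSpace N × RBPhaseSpace N) → ℝ} (hΘ : ContDiff ℝ ∞ Θ)
    (w : ℝ × (RBPhaseSpace N × RBPhaseSpace N)) :
    hormanderTranspose (P.rbDoubledFamily Λ N T_L T_R none)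
        (fun j => P.rbDoubledFamily Λ N T_L T_R (some j)) (fun _ => 2 * P.γ) Θ w =
      2 * fderiv ℝ Θ w (1, 0) +
        P.rbGenerator Λ N T_L T_R (fun y' => Θ (w.1, (w.2.1, y'))) w.2.2 +
        (sdeGeneratorFst (fun y => -P.rbDrift Λ N y) (P.rbNoiseVec N T_L T_R 0) (P.rbNoiseVec N T_L T_R 1)
            (fun p => Θ (w.1, p)) w.2 + 2 * P.γ * Θ w) := by
  obtain ⟨t, x, y⟩ := w
  have hΘ2 : ContDiff ℝ 2 Θ := hΘ.of_le (by norm_cast)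
  have hΘd : Differentiable ℝ Θ := hΘ.differentiable (by simp)
  -- the slices
  have hgy : ContDiff ℝ ∞ (fun y' => Θ (t, (x, y'))) :=
    hΘ.comp (contDiff_const.prodMk (contDiff_const.prodMk contDiff_id))
  have hhx : ContDiff ℝ ∞ (fun x' => Θ (t, (x', y))) :=
    hΘ.comp (contDiff_const.prodMk (contDiff_id.prodMk contDiff_const))
  -- the right-hand side in Hörmander form
  rw [P.rbGenerator_eq_hormanderOp Λ hL hR hgy y, hormanderOp, sdeGeneratorFst_apply,
    P.sdeGenerator_neg_rbDrift_eq Λ hL hR hhx x, hormanderTranspose, Fintype.sum_sum_type]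
  simp only [zero_mul, add_zero]
  -- the constant noise fields in `x`
  have hxb : ∀ b : Fin 2,
      fieldTranspose (P.rbDoubledFamily Λ N T_L T_R (some (Sum.inl b)))
        (fieldTranspose (P.rbDoubledFamily Λ N T_L T_R (some (Sum.inl b))) Θ) (t, (x, y)) =
      fieldDeriv (P.rbBathField (N := N) T_L T_R b)
        (fieldDeriv (P.rbBathField (N := N) T_L T_R b) fun x' => Θ (t, (x', y))) x := by
    intro b
    set v : RBPhaseSpace N := P.rbBathField (N := N) T_L T_R b x with hv
    have e1 : P.rbDoubledFamily Λ N T_L T_R (some (Sum.inl b)) =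
        fun _ => ((0 : ℝ), (v, (0 : RBPhaseSpace N))) := by
      funext q; rfl
    have e3 : fieldDeriv (P.rbBathField (N := N) T_L T_R b)
        (fieldDeriv (P.rbBathField (N := N) T_L T_R b) fun x' => Θ (t, (x', y))) x =
        fderiv ℝ (fun x' => fderiv ℝ (fun x'' => Θ (t, (x'', y))) x' v) x v := rfl
    rw [e1, fieldTranspose_fieldTranspose_const_apply, e3, fderiv_fderiv_xSlice_apply hΘ2 t x y v]
  -- the constant noise fields in `y`
  have hyb : ∀ b : Fin 2,
      fieldTranspose (P.rbDoubledFamily Λ N T_L T_R (some (Sum.inr b)))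
        (fieldTranspose (P.rbDoubledFamily Λ N T_L T_R (some (Sum.inr b))) Θ) (t, (x, y)) =
      fieldDeriv (P.rbBathField (N := N) T_L T_R b)
        (fieldDeriv (P.rbBathField (N := N) T_L T_R b) fun y' => Θ (t, (x, y'))) y := by
    intro b
    set v : RBPhaseSpace N := P.rbBathField (N := N) T_L T_R b y with hv
    have e1 : P.rbDoubledFamily Λ N T_L T_R (some (Sum.inr b)) =
        fun _ => ((0 : ℝ), ((0 : RBPhaseSpace N), v)) := by
      funext q; rfl
    have e3 : fieldDeriv (P.rbBathField (N := N) T_L T_R b)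
        (fieldDeriv (P.rbBathField (N := N) T_L T_R b) fun y' => Θ (t, (x, y'))) y =
        fderiv ℝ (fun y' => fderiv ℝ (fun y'' => Θ (t, (x, y''))) y' v) y v := rfl
    rw [e1, fieldTranspose_fieldTranspose_const_apply, e3, fderiv_fderiv_ySlice_apply hΘ2 t x y v]
  -- the drift: divergence zero, and `DΘ·Z̃₀ = -2∂_tΘ + DΘ·(0,X₀x,0) - DΘ·(0,0,X₀y)`
  have h0 : fieldTranspose (P.rbDoubledFamily Λ N T_L T_R none) Θ (t, (x, y)) =
      2 * fderiv ℝ Θ (t, (x, y)) (1, 0) - fderiv ℝ (fun x' => Θ (t, (x', y))) x (P.rbDrift Λ N x) +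
        fieldDeriv (P.rbDrift Λ N) (fun y' => Θ (t, (x, y'))) y := by
    have hXd : Differentiable ℝ (P.rbDrift Λ N) := (P.contDiff_rbDrift hU hV Λ N).differentiable (by simp)
    have hdiv : fieldDiv (P.rbDoubledFamily Λ N T_L T_R none) (t, (x, y)) = 0 := by
      have e1 : P.rbDoubledFamily Λ N T_L T_R none =
          liftField (-2) (pairField (P.rbDrift Λ N) fun y' => -P.rbDrift Λ N y') := rfl
      have hpd : DifferentiableAt ℝ (pairField (P.rbDrift Λ N) fun y' => -P.rbDrift Λ N y') (x, y) :=
        ((contDiff_pairField (P.contDiff_rbDrift hU hV Λ N) (P.contDiff_rbDrift hU hV Λ N).neg).differentiable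
          (by simp)) _
      have hnd : DifferentiableAt ℝ (fun y' => -P.rbDrift Λ N y') y := (hXd y).neg
      rw [e1, fieldDiv_liftField (-2) (p := (t, (x, y))) hpd]
      show fieldDiv (pairField (P.rbDrift Λ N) fun y' => -P.rbDrift Λ N y') (x, y) = 0
      rw [fieldDiv_pairField (p := (x, y)) (hXd x) hnd]
      have hneg : fieldDiv (fun y' => -P.rbDrift Λ N y') y = -fieldDiv (P.rbDrift Λ N) y := by
        unfold fieldDiv
        rw [fderiv_fun_neg]
        simp only [ContinuousLinearMap.toLinearMap_neg, map_neg]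
      rw [hneg, P.fieldDiv_rbDrift hU hV Λ N, P.fieldDiv_rbDrift hU hV Λ N]
      ring
    rw [fieldTranspose, hdiv, fieldDeriv, fieldDeriv, rbDoubledFamily_none]
    have e2 : ((-2 : ℝ), (P.rbDrift Λ N x, -P.rbDrift Λ N y)) =
        -((2 : ℝ) • ((1 : ℝ), (0 : RBPhaseSpace N × RBPhaseSpace N))) +
          ((0 : ℝ), (P.rbDrift Λ N x, (0 : RBPhaseSpace N))) - ((0 : ℝ), ((0 : RBPhaseSpace N), P.rbDrift Λ N y)) := by
      ext <;> simp
    rw [show ((t, (x, y)) : ℝ × (RBPhaseSpace N × RBPhaseSpace N)).2.1 = x from rfl,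
      show ((t, (x, y)) : ℝ × (RBPhaseSpace N × RBPhaseSpace N)).2.2 = y from rfl, e2, map_sub, map_add,
      map_neg, map_smul, fderiv_xSlice_apply hΘd t x y, fderiv_ySlice_apply hΘd t x y]
    simp only [smul_eq_mul, zero_mul, sub_zero]
    ring
  rw [Finset.sum_congr rfl fun b _ => hxb b, Finset.sum_congr rfl fun b _ => hyb b, h0, fieldDeriv]
  ring

end OscillatorChain

/-! ### The joint kernel and the joint law of a Markov semigroup -/

namespace MarkovSemigroupFor

variable {X : Type*} [MeasurableSpace X] [NormedAddCommGroup X] [NormedSpace ℝ X]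
  {L : (X → ℝ) → X → ℝ} (S : MarkovSemigroupFor L)

/-- The kernel `(t, x) ↦ P_{t⁺}(x, ·)` from time-space. [folklore] -/
def jointKernel : Kernel (ℝ × X) X :=
  ⟨fun q => S.kernel q.1.toNNReal q.2,
    S.measurable_kernel.comp ((measurable_real_toNNReal.comp measurable_fst).prodMk measurable_snd)⟩

/-- Unfolding `jointKernel`. [folklore] -/
@[simp] theorem jointKernel_apply (q : ℝ × X) : S.jointKernel q = S.kernel q.1.toNNReal q.2 := rfl

/-- The joint kernel is a Markov kernel. [folklore] -/
instance isMarkovKernel_jointKernel : IsMarkovKernel S.jointKernel :=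
  ⟨fun q => by rw [jointKernel_apply]; infer_instance⟩

end MarkovSemigroupFor

namespace MarkovSemigroupFor

variable {X : Type*} [MeasureSpace X] [NormedAddCommGroup X] [NormedSpace ℝ X] [BorelSpace X]
  {L : (X → ℝ) → X → ℝ} (S : MarkovSemigroupFor L)

/-- The base measure `1_{t>0} dt dx` on `ℝ × X`. [folklore] -/
def baseMeasure (X : Type*) [MeasureSpace X] : Measure (ℝ × X) :=
  ((volume : Measure ℝ).restrict (Ioi 0)).prod (volume : Measure X)

omit [NormedAddCommGroup X] [NormedSpace ℝ X] [BorelSpace X] in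
/-- The base measure is the restriction of the volume of `ℝ × X` to `(0,∞) × X`. [folklore] -/
theorem baseMeasure_eq [SFinite (volume : Measure X)] :
    baseMeasure X = (volume : Measure (ℝ × X)).restrict (Ioi (0 : ℝ) ×ˢ (univ : Set X)) := by
  rw [baseMeasure, show (volume : Measure (ℝ × X)) = (volume : Measure ℝ).prod (volume : Measure X) from rfl,
    ← Measure.prod_restrict, Measure.restrict_univ]

/-- The base measure is s-finite. [folklore] -/
instance sFinite_baseMeasure [SFinite (volume : Measure X)] : SFinite (baseMeasure X) := by
  unfold baseMeasure; infer_instance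

/-- **The joint law** `m(dt, dx, dy) = 1_{t>0} dt dx P_t(x, dy)` on `ℝ × X × X`, `dx` the
reference (volume) measure: the law in `(t, x, y)` of "time, starting point, position", the object
whose density is the transition density `p_t(x, y)`. [folklore] -/
def jointLaw : Measure (ℝ × (X × X)) :=
  (baseMeasure X ⊗ₘ S.jointKernel).map (MeasurableEquiv.prodAssoc (α := ℝ) (β := X) (γ := X))

variable [SFinite (volume : Measure X)]

omit [BorelSpace X] in
/-- The joint law of a product set `J × (A × univ)` is `vol(J ∩ (0,∞)) · vol(A)`. [folklore] -/
theorem jointLaw_apply_prod {J : Set ℝ} (hJ : MeasurableSet J) {A : Set X} (hA : MeasurableSet A) :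
    S.jointLaw (J ×ˢ (A ×ˢ (univ : Set X))) = volume (J ∩ Ioi 0) * volume A := by
  rw [jointLaw, Measure.map_apply (MeasurableEquiv.prodAssoc (α := ℝ) (β := X) (γ := X)).measurable
    (hJ.prod (hA.prod MeasurableSet.univ))]
  have hpre : (MeasurableEquiv.prodAssoc (α := ℝ) (β := X) (γ := X)) ⁻¹' (J ×ˢ (A ×ˢ (univ : Set X))) =
      (J ×ˢ A) ×ˢ (univ : Set X) := by
    ext ⟨⟨t, x⟩, y⟩
    simp [MeasurableEquiv.prodAssoc]
  rw [hpre, Measure.compProd_apply_prod (hJ.prod hA) MeasurableSet.univ]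
  simp_rw [measure_univ]
  rw [setLIntegral_const, one_mul, baseMeasure, Measure.prod_prod, Measure.restrict_apply hJ]

/-- The joint law is locally finite. [folklore] -/
instance isLocallyFiniteMeasure_jointLaw [IsLocallyFiniteMeasure (volume : Measure X)] :
    IsLocallyFiniteMeasure S.jointLaw := by
  refine ⟨fun w => ?_⟩
  obtain ⟨U, hU, hUo, hUfin⟩ := Measure.exists_isOpen_measure_lt_top (volume : Measure X) w.2.1
  refine ⟨Ioo (w.1 - 1) (w.1 + 1) ×ˢ (U ×ˢ univ), prod_mem_nhds (Ioo_mem_nhds (by linarith) (by linarith))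
    (prod_mem_nhds (hUo.mem_nhds hU) univ_mem), ?_⟩
  rw [S.jointLaw_apply_prod measurableSet_Ioo hUo.measurableSet]
  refine ENNReal.mul_lt_top (lt_of_le_of_lt (measure_mono inter_subset_left) ?_) hUfin
  rw [Real.volume_Ioo]
  exact ENNReal.ofReal_lt_top

omit [BorelSpace X] [SFinite (volume : Measure X)] in
/-- Integration against the joint law reduces to the compound measure `base ⊗ P`. [folklore] -/
theorem integral_jointLaw_eq_integral_compProd {Θ : ℝ × (X × X) → ℝ}
    (hΘ : AEStronglyMeasurable Θ S.jointLaw) :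
    ∫ w, Θ w ∂S.jointLaw =
      ∫ q, Θ (MeasurableEquiv.prodAssoc (α := ℝ) (β := X) (γ := X) q) ∂(baseMeasure X ⊗ₘ S.jointKernel) := by
  rw [jointLaw] at hΘ ⊢
  rw [integral_map (MeasurableEquiv.prodAssoc (α := ℝ) (β := X) (γ := X)).measurable.aemeasurable hΘ]

end MarkovSemigroupFor

/-! ### The joint law of (RBT-SDE): pairing, and annihilation by `ᵗP̃` -/

namespace OscillatorChain

variable (P : OscillatorChain)

/-- `∂_t` through the embedding `(t, y) ↦ (t, x, y)`: the time derivative of the slice family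
`Ψ_x(t, y) = Θ(t, x, y)` is that of `Θ`. [folklore] -/
theorem fderiv_timeEmbed_apply {X : Type*} [NormedAddCommGroup X] [NormedSpace ℝ X]
    {Θ : ℝ × (X × X) → ℝ} (hΘ : Differentiable ℝ Θ) (x : X) (t : ℝ) (y : X) :
    fderiv ℝ (fun q : ℝ × X => Θ (q.1, (x, q.2))) (t, y) (1, 0) = fderiv ℝ Θ (t, (x, y)) (1, 0) := by
  set J : ℝ × X →L[ℝ] ℝ × (X × X) :=
    (ContinuousLinearMap.fst ℝ ℝ X).prod ((0 : ℝ × X →L[ℝ] X).prod (ContinuousLinearMap.snd ℝ ℝ X)) with hJ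
  have h1 : HasFDerivAt (fun q : ℝ × X => ((q.1, (x, q.2)) : ℝ × (X × X))) J (t, y) := by
    have ha : HasFDerivAt (fun q : ℝ × X => q.1) (ContinuousLinearMap.fst ℝ ℝ X) (t, y) := hasFDerivAt_fst
    have hb : HasFDerivAt (fun q : ℝ × X => ((x, q.2) : X × X))
        ((0 : ℝ × X →L[ℝ] X).prod (ContinuousLinearMap.snd ℝ ℝ X)) (t, y) :=
      (hasFDerivAt_const x _).prodMk hasFDerivAt_snd
    exact ha.prodMk hb
  have h2 : HasFDerivAt (fun q : ℝ × X => Θ (q.1, (x, q.2))) ((fderiv ℝ Θ (t, (x, y))).comp J) (t, y) :=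
    (hΘ (t, (x, y))).hasFDerivAt.comp (t, y) h1
  rw [h2.fderiv, ContinuousLinearMap.comp_apply]
  congr 1

section JointLaw

variable {P} {k₁ k₂ : ℝ} (hU : RBGrowth P.U k₁) (hV : RBGrowth P.V k₂) (hk₁ : 1 ≤ k₁) (hk₂ : 1 ≤ k₂)
  (hγ : 0 ≤ P.γ) (Λ : ℝ) {T_L T_R : ℝ} (hL : 0 ≤ T_L) (hR : 0 ≤ T_R)

/-- A compact time-start-point set off which a compactly supported function on `ℝ × X × X`
vanishes. [folklore] -/
theorem exists_compact_timeStart {Θ : ℝ × (RBPhaseSpace N × RBPhaseSpace N) → ℝ}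
    (hΘc : HasCompactSupport Θ) :
    ∃ K₂ : Set (ℝ × RBPhaseSpace N), IsCompact K₂ ∧
      ∀ (t : ℝ) (x : RBPhaseSpace N), (t, x) ∉ K₂ → ∀ y, Θ (t, (x, y)) = 0 := by
  refine ⟨(fun w : ℝ × (RBPhaseSpace N × RBPhaseSpace N) => (w.1, w.2.1)) '' tsupport Θ,
    hΘc.image (continuous_fst.prodMk (continuous_fst.comp continuous_snd)), fun t x hx y => ?_⟩
  exact image_eq_zero_of_notMem_tsupport fun hmem => hx ⟨(t, (x, y)), hmem, rfl⟩

/-- A continuous compactly supported function is bounded by a nonnegative constant. [folklore] -/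
theorem exists_bound_of_hasCompactSupport₃ {Θ : ℝ × (RBPhaseSpace N × RBPhaseSpace N) → ℝ}
    (hΘ : Continuous Θ) (hΘc : HasCompactSupport Θ) : ∃ C, 0 ≤ C ∧ ∀ w, ‖Θ w‖ ≤ C := by
  obtain ⟨C, hC⟩ := hΘ.bounded_above_of_compact_support hΘc
  exact ⟨max C 0, le_max_right _ _, fun w => (hC w).trans (le_max_left _ _)⟩

include hU hV hk₁ hk₂ hγ hL hR

/-- **The inner integral `(t, x) ↦ ∫ Θ(t, x, y) P_{t⁺}(x, dy)`** of a continuous compactly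
supported `Θ` is strongly measurable, bounded by `C 1_{K₂}`, hence integrable on the base
`(0,∞) × X`; and `Θ` read on `(ℝ × X) × X` is integrable against `base ⊗ P`. [folklore] -/
theorem integrable_inner_rbKernel {Θ : ℝ × (RBPhaseSpace N × RBPhaseSpace N) → ℝ}
    (hΘ : Continuous Θ) (hΘc : HasCompactSupport Θ) :
    Integrable (fun q : ℝ × RBPhaseSpace N =>
        ∫ y, Θ (q.1, (q.2, y)) ∂(P.rbKernel Λ N T_L T_R q.1.toNNReal q.2))
      (MarkovSemigroupFor.baseMeasure (RBPhaseSpace N)) ∧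
    Integrable (fun z : (ℝ × RBPhaseSpace N) × RBPhaseSpace N => Θ (z.1.1, (z.1.2, z.2)))
      (MarkovSemigroupFor.baseMeasure (RBPhaseSpace N) ⊗ₘ
        (P.rbSemigroup hU hV hk₁ hk₂ hγ Λ N T_L T_R hL hR).jointKernel) := by
  set S := P.rbSemigroup hU hV hk₁ hk₂ hγ Λ N T_L T_R hL hR with hS
  obtain ⟨K₂, hK₂, hΘK₂⟩ := exists_compact_timeStart hΘc
  obtain ⟨C, hC0, hC⟩ := exists_bound_of_hasCompactSupport₃ hΘ hΘc
  have hf : StronglyMeasurable fun z : (ℝ × RBPhaseSpace N) × RBPhaseSpace N => Θ (z.1.1, (z.1.2, z.2)) :=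
    (hΘ.comp ((continuous_fst.comp continuous_fst).prodMk
      ((continuous_snd.comp continuous_fst).prodMk continuous_snd))).stronglyMeasurable
  -- measurability of the inner integral through the joint kernel
  have hmeas : StronglyMeasurable fun q : ℝ × RBPhaseSpace N =>
      ∫ y, Θ (q.1, (q.2, y)) ∂(P.rbKernel Λ N T_L T_R q.1.toNNReal q.2) :=
    hf.integral_kernel_prod_right' (κ := S.jointKernel)
  -- the majorants
  have hfin : MarkovSemigroupFor.baseMeasure (RBPhaseSpace N) K₂ < ⊤ := by
    rw [MarkovSemigroupFor.baseMeasure_eq]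
    exact lt_of_le_of_lt (Measure.restrict_apply_le _ _) hK₂.measure_lt_top
  have hdom : Integrable (K₂.indicator fun _ => C) (MarkovSemigroupFor.baseMeasure (RBPhaseSpace N)) :=
    (integrableOn_const hfin.ne).integrable_indicator hK₂.measurableSet
  have hfin' : (MarkovSemigroupFor.baseMeasure (RBPhaseSpace N) ⊗ₘ S.jointKernel)
      (K₂ ×ˢ (univ : Set (RBPhaseSpace N))) < ⊤ := by
    rw [Measure.compProd_apply_prod hK₂.measurableSet MeasurableSet.univ]
    simp_rw [measure_univ]
    rw [setLIntegral_const, one_mul]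
    exact hfin
  have hdom' : Integrable ((K₂ ×ˢ (univ : Set (RBPhaseSpace N))).indicator fun _ => C)
      (MarkovSemigroupFor.baseMeasure (RBPhaseSpace N) ⊗ₘ S.jointKernel) :=
    (integrableOn_const hfin'.ne).integrable_indicator (hK₂.measurableSet.prod MeasurableSet.univ)
  refine ⟨hdom.mono' hmeas.aestronglyMeasurable (Eventually.of_forall fun q => ?_),
    hdom'.mono' hf.aestronglyMeasurable (Eventually.of_forall fun z => ?_)⟩
  · by_cases hq : q ∈ K₂
    · rw [indicator_of_mem hq]
      haveI : IsProbabilityMeasure (P.rbKernel Λ N T_L T_R q.1.toNNReal q.2) :=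
        (P.isMarkovKernel_rbKernel hU hV hk₁ hk₂ hγ Λ N T_L T_R q.1.toNNReal).isProbabilityMeasure q.2
      calc ‖∫ y, Θ (q.1, (q.2, y)) ∂(P.rbKernel Λ N T_L T_R q.1.toNNReal q.2)‖
          ≤ C * (P.rbKernel Λ N T_L T_R q.1.toNNReal q.2).real univ :=
            norm_integral_le_of_norm_le_const (Eventually.of_forall fun y => hC _)
        _ = C := by simp
    · have h0 : (fun y => Θ (q.1, (q.2, y))) = fun _ => 0 := funext fun y => hΘK₂ q.1 q.2 hq y
      rw [h0, integral_zero, norm_zero, indicator_of_notMem hq]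
  · by_cases hz : z.1 ∈ K₂
    · rw [indicator_of_mem (show z ∈ K₂ ×ˢ (univ : Set (RBPhaseSpace N)) from ⟨hz, mem_univ _⟩)]
      exact hC _
    · rw [hΘK₂ z.1.1 z.1.2 hz z.2, norm_zero, indicator_of_notMem (fun h => hz h.1)]

/-- **Integration against the joint law of (RBT-SDE)**:
`∫ Θ dm = ∫_{(0,∞) × X} (∫ Θ(t, x, y) P_t(x, dy)) dt dx` for continuous compactly supported `Θ`.
[folklore] -/
theorem integral_jointLaw_eq {Θ : ℝ × (RBPhaseSpace N × RBPhaseSpace N) → ℝ}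
    (hΘ : Continuous Θ) (hΘc : HasCompactSupport Θ) :
    ∫ w, Θ w ∂(P.rbSemigroup hU hV hk₁ hk₂ hγ Λ N T_L T_R hL hR).jointLaw =
      ∫ q, (∫ y, Θ (q.1, (q.2, y)) ∂(P.rbKernel Λ N T_L T_R q.1.toNNReal q.2))
        ∂(MarkovSemigroupFor.baseMeasure (RBPhaseSpace N)) := by
  set S := P.rbSemigroup hU hV hk₁ hk₂ hγ Λ N T_L T_R hL hR with hS
  obtain ⟨-, hint⟩ := integrable_inner_rbKernel hU hV hk₁ hk₂ hγ Λ hL hR hΘ hΘc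
  rw [S.integral_jointLaw_eq_integral_compProd hΘ.aestronglyMeasurable]
  have heq : (fun q : (ℝ × RBPhaseSpace N) × RBPhaseSpace N =>
      Θ (MeasurableEquiv.prodAssoc (α := ℝ) (β := RBPhaseSpace N) (γ := RBPhaseSpace N) q)) =
      fun z => Θ (z.1.1, (z.1.2, z.2)) := by
    funext z; rfl
  rw [heq, Measure.integral_compProd hint]
  rfl

/-- **The joint law of (RBT-SDE) is annihilated by `ᵗP̃`**: for every `Θ ∈ C_c^∞(ℝ × X × X)`
supported in `(0,∞) × X × X`, `∫ (ᵗP̃ Θ) dm = 0` — the forward equation in `(t, y)` for each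
starting point `x` (then Fubini in `(t, x)`), plus the backward equation in `(t, x)`.
[cite: ReyBelletThomas2002, §4] -/
theorem rb_jointLaw_annihilated {Θ : ℝ × (RBPhaseSpace N × RBPhaseSpace N) → ℝ} (hΘ : ContDiff ℝ ∞ Θ)
    (hΘc : HasCompactSupport Θ) (hΘ0 : tsupport Θ ⊆ Set.Ioi (0 : ℝ) ×ˢ Set.univ) :
    ∫ w, hormanderTranspose (P.rbDoubledFamily Λ N T_L T_R none)
        (fun j => P.rbDoubledFamily Λ N T_L T_R (some j)) (fun _ => 2 * P.γ) Θ w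
      ∂(P.rbSemigroup hU hV hk₁ hk₂ hγ Λ N T_L T_R hL hR).jointLaw = 0 := by
  haveI := isAddHaarMeasure_volume_rbPhaseSpace N
  haveI : SFinite (volume : Measure (RBPhaseSpace N)) := inferInstance
  haveI : IsLocallyFiniteMeasure (volume : Measure (RBPhaseSpace N)) := inferInstance
  set S := P.rbSemigroup hU hV hk₁ hk₂ hγ Λ N T_L T_R hL hR with hS
  haveI : IsLocallyFiniteMeasure S.jointLaw := S.isLocallyFiniteMeasure_jointLaw
  have hγL : 0 ≤ P.γ * T_L := mul_nonneg hγ hL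
  have hγR : 0 ≤ P.γ * T_R := mul_nonneg hγ hR
  have hY'c : Continuous fun y : RBPhaseSpace N => -P.rbDrift Λ N y :=
    (P.contDiff_rbDrift hU.1 hV.1 Λ N).continuous.neg
  -- the two halves `G_f = ∂_tΘ + L_yΘ`, `G_b = ∂_tΘ + L̂_xΘ + 2γΘ`
  set Gb : ℝ × (RBPhaseSpace N × RBPhaseSpace N) → ℝ := fun w => fderiv ℝ Θ w (1, 0) +
    (sdeGeneratorFst (fun y => -P.rbDrift Λ N y) (P.rbNoiseVec N T_L T_R 0) (P.rbNoiseVec N T_L T_R 1)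
        (fun p => Θ (w.1, p)) w.2 + 2 * P.γ * Θ w) with hGb
  set TP : ℝ × (RBPhaseSpace N × RBPhaseSpace N) → ℝ := hormanderTranspose (P.rbDoubledFamily Λ N T_L T_R none)
    (fun j => P.rbDoubledFamily Λ N T_L T_R (some j)) (fun _ => 2 * P.γ) Θ with hTP
  set Gf : ℝ × (RBPhaseSpace N × RBPhaseSpace N) → ℝ := fun w => TP w - Gb w with hGf
  have hTPs : ContDiff ℝ ∞ TP := contDiff_hormanderTranspose (P.contDiff_rbDoubledFamily hU.1 hV.1 Λ N T_L T_R none)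
    (fun j => P.contDiff_rbDoubledFamily hU.1 hV.1 Λ N T_L T_R (some j)) contDiff_const hΘ
  have hTPc : HasCompactSupport TP := hΘc.mono' ((subset_tsupport _).trans (tsupport_hormanderTranspose_subset _ _ _ Θ))
  have hGbc : Continuous Gb :=
    (contDiff_timeDeriv hΘ).continuous.add
      ((continuous_sdeGeneratorFst_family hY'c (hΘ.of_le (WithTop.coe_le_coe.2 le_top))).add
        (continuous_const.mul hΘ.continuous))
  have hGbs : HasCompactSupport Gb :=
    (hasCompactSupport_timeDeriv hΘc).add ((hasCompactSupport_sdeGeneratorFst_family hΘc).add hΘc.mul_left)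
  have hGfc : Continuous Gf := hTPs.continuous.sub hGbc
  have hGfs : HasCompactSupport Gf := hTPc.sub hGbs
  -- `G_f = ∂_tΘ + L_yΘ` pointwise (the transpose identity)
  have hGf_eq : ∀ (t : ℝ) (x y : RBPhaseSpace N), Gf (t, (x, y)) =
      fderiv ℝ (fun q : ℝ × RBPhaseSpace N => Θ (q.1, (x, q.2))) (t, y) (1, 0) +
        P.rbGenerator Λ N T_L T_R (fun y' => Θ (t, (x, y'))) y := by
    intro t x y
    simp only [hGf, hTP, hGb]
    rw [P.hormanderTranspose_rbDoubled hU.1 hV.1 Λ hγL hγR hΘ (t, (x, y)),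
      fderiv_timeEmbed_apply (hΘ.differentiable (by simp)) x t y]
    ring
  -- split the integral
  have hsplit : (fun w => TP w) = fun w => Gf w + Gb w := funext fun w => by simp [hGf]
  have hiGf : Integrable Gf S.jointLaw := hGfc.integrable_of_hasCompactSupport hGfs
  have hiGb : Integrable Gb S.jointLaw := hGbc.integrable_of_hasCompactSupport hGbs
  change ∫ w, TP w ∂S.jointLaw = 0
  rw [hsplit, integral_add hiGf hiGb]
  -- the backward half
  have hback : ∫ w, Gb w ∂S.jointLaw = 0 := by
    obtain ⟨hint, -⟩ := integrable_inner_rbKernel hU hV hk₁ hk₂ hγ Λ hL hR hGbc hGbs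
    rw [integral_jointLaw_eq hU hV hk₁ hk₂ hγ Λ hL hR hGbc hGbs, MarkovSemigroupFor.baseMeasure,
      integral_prod _ hint]
    have h := P.rb_backwardEquation hU hV hk₁ hk₂ hγ Λ N T_L T_R hΘ hΘc hΘ0
    simp only [pairAct_def] at h
    exact h
  -- the forward half: Fubini in `(t, x)` and the forward equation for each `x`
  have hfwd : ∫ w, Gf w ∂S.jointLaw = 0 := by
    obtain ⟨hint, -⟩ := integrable_inner_rbKernel hU hV hk₁ hk₂ hγ Λ hL hR hGfc hGfs
    rw [integral_jointLaw_eq hU hV hk₁ hk₂ hγ Λ hL hR hGfc hGfs, MarkovSemigroupFor.baseMeasure,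
      integral_prod_symm _ hint]
    refine integral_eq_zero_of_ae (Eventually.of_forall fun x => ?_)
    -- the slice family at the starting point `x`
    set Ψ : ℝ × RBPhaseSpace N → ℝ := fun q => Θ (q.1, (x, q.2)) with hΨ
    have hΨs : ContDiff ℝ ∞ Ψ := hΘ.comp (contDiff_fst.prodMk (contDiff_const.prodMk contDiff_snd))
    have hΨc : HasCompactSupport Ψ := by
      refine HasCompactSupport.intro (hΘc.image (continuous_fst.prodMk (continuous_snd.comp continuous_snd)))
        fun q hq => ?_
      by_contra h
      exact hq ⟨(q.1, (x, q.2)), subset_tsupport _ (Function.mem_support.2 h), rfl⟩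
    have hΨ0 : tsupport Ψ ⊆ Set.Ioi (0 : ℝ) ×ˢ Set.univ := by
      intro q hq
      have hsub : tsupport Ψ ⊆ (fun q : ℝ × RBPhaseSpace N => ((q.1, (x, q.2)) : ℝ × (RBPhaseSpace N × RBPhaseSpace N))) ⁻¹'
          tsupport Θ := by
        refine closure_minimal (fun q' hq' => subset_tsupport _ hq') ?_
        exact (isClosed_tsupport Θ).preimage (continuous_fst.prodMk (continuous_const.prodMk continuous_snd))
      exact ⟨(hΘ0 (hsub hq)).1, mem_univ _⟩
    have h := P.rb_forwardEquation hU.1 hV.1 hγL hγR S hΨs hΨc hΨ0 x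
    have heq : ∀ t : ℝ, ∫ y, Gf (t, (x, y)) ∂(P.rbKernel Λ N T_L T_R t.toNNReal x) =
        S.act t.toNNReal (fun y => fderiv ℝ Ψ (t, y) (1, 0) +
          P.rbGenerator Λ N T_L T_R (fun y' => Ψ (t, y')) y) x := by
      intro t
      rw [MarkovSemigroupFor.act_apply]
      exact integral_congr_ae (Eventually.of_forall fun y => hGf_eq t x y)
    simp only
    simp_rw [heq]
    exact h
  rw [hfwd, hback, add_zero]

end JointLaw

/-! ### The joint smoothness of the transition densities -/

section Density

variable {P} {k₁ k₂ : ℝ} (hU : RBGrowth P.U k₁) (hV : RBGrowth P.V k₂) (hk₁ : 1 ≤ k₁) (hk₂ : 1 ≤ k₂)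
  (hγ : 0 < P.γ) (Λ : ℝ) {T_L T_R : ℝ} (hL : 0 < T_L) (hR : 0 < T_R)
include hU hV hk₁ hk₂ hγ hL hR

/-- **`(t, x) ↦ ∫ c dP_t(x, ·)` is jointly continuous** for `c ∈ C_c^∞`: Lipschitz in `t`
uniformly in `x` (Dynkin), continuous in `x` (Feller). [folklore] -/
theorem continuous_act_rbSemigroup_timeStart {c : RBPhaseSpace N → ℝ} (hc : ContDiff ℝ ∞ c)
    (hcc : HasCompactSupport c) :
    Continuous fun q : ℝ × RBPhaseSpace N =>
      (P.rbSemigroup hU hV hk₁ hk₂ hγ.le Λ N T_L T_R hL.le hR.le).act q.1.toNNReal c q.2 := by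
  set S := P.rbSemigroup hU hV hk₁ hk₂ hγ.le Λ N T_L T_R hL.le hR.le with hS
  have hc2 : ContDiff ℝ 2 c := hc.of_le (by norm_cast)
  have hU1 : ContDiff ℝ 1 P.U := hU.1.of_le (by norm_cast)
  have hV1 : ContDiff ℝ 1 P.V := hV.1.of_le (by norm_cast)
  obtain ⟨C, hC⟩ := P.exists_bound_rbGenerator hU1 hV1 Λ N T_L T_R hc2 hcc
  have hLc := P.continuous_rbGenerator hU1 hV1 Λ N T_L T_R hc2
  have hC0 : 0 ≤ C := (norm_nonneg _).trans (hC 0)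
  obtain ⟨Cc, hCc⟩ := hc.continuous.bounded_above_of_compact_support hcc
  -- continuity in `x` at a fixed time (Feller)
  let cb : RBPhaseSpace N →ᵇ ℝ := BoundedContinuousFunction.ofNormedAddCommGroup c hc.continuous Cc hCc
  have hFeller : ∀ t : ℝ≥0, Continuous (S.act t c) := fun t => by
    have h := OscillatorChain.continuous_act_rbSemigroup hU hV hk₁ hk₂ hγ.le Λ N hL.le hR.le t cb
    exact h
  refine continuous_iff_continuousAt.2 fun q₀ => ?_
  rw [Metric.continuousAt_iff]
  intro ε hε
  obtain ⟨δ₁, hδ₁, h1⟩ := Metric.continuousAt_iff.1 (hFeller q₀.1.toNNReal).continuousAt (ε / 2) (by positivity)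
  refine ⟨min δ₁ (ε / (2 * (C + 1))), lt_min hδ₁ (by positivity), fun q hq => ?_⟩
  rw [Prod.dist_eq] at hq
  have hq1 : dist q.2 q₀.2 < δ₁ := (le_max_right _ _).trans_lt (hq.trans_le (min_le_left _ _))
  have hq2 : dist q.1 q₀.1 < ε / (2 * (C + 1)) := (le_max_left _ _).trans_lt (hq.trans_le (min_le_right _ _))
  have htoNN : |((q.1.toNNReal : ℝ≥0) : ℝ) - q₀.1.toNNReal| ≤ |q.1 - q₀.1| := by
    have h := abs_max_sub_max_le_max q.1 0 q₀.1 0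
    have h0 : max |q.1 - q₀.1| |(0 : ℝ) - 0| = |q.1 - q₀.1| := by
      rw [sub_self, abs_zero]
      exact max_eq_left (abs_nonneg _)
    rw [h0] at h
    rw [Real.coe_toNNReal', Real.coe_toNNReal']
    exact h
  have ht : |S.act q.1.toNNReal c q.2 - S.act q₀.1.toNNReal c q.2| ≤ C * |q.1 - q₀.1| :=
    (S.abs_act_sub_act_le hc hcc hLc hC q.1.toNNReal q₀.1.toNNReal q.2).trans
      (mul_le_mul_of_nonneg_left htoNN hC0)
  have h1' := h1 hq1
  rw [Real.dist_eq] at h1' hq2 ⊢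
  have hC1' : (C + 1) ≠ 0 := (by positivity : (0 : ℝ) < C + 1).ne'
  have hC1 : C * |q.1 - q₀.1| < ε / 2 := by
    calc C * |q.1 - q₀.1| ≤ C * (ε / (2 * (C + 1))) := mul_le_mul_of_nonneg_left hq2.le hC0
      _ = ε / 2 * (C / (C + 1)) := by field_simp
      _ < ε / 2 := mul_lt_of_lt_one_right (by positivity) ((div_lt_one (by positivity)).2 (by linarith))
  calc |S.act q.1.toNNReal c q.2 - S.act q₀.1.toNNReal c q₀.2|
      ≤ |S.act q.1.toNNReal c q.2 - S.act q₀.1.toNNReal c q.2| +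
          |S.act q₀.1.toNNReal c q.2 - S.act q₀.1.toNNReal c q₀.2| := abs_sub_le _ _ _
    _ < ε / 2 + ε / 2 := add_lt_add (ht.trans_lt hC1) h1'
    _ = ε := by ring

/-- **Rey-Bellet–Thomas 2002, Theorem 2.1, first clause, for the constructed process, from
Hörmander's theorem**: "The Markov process `x(t)` which solves (12) has smooth transition
probability densities, `P_t(x, dy) = p_t(x, y) dy`, with `p_t(x, y) ∈ C^∞((0, ∞) × X × X)`."
Assuming `Hormander1967_thm11`, under H1 (growth exponents `≥ 1`, for the construction of the
kernels), H2, `Λ ≠ 0`, `γ, T_L, T_R > 0`: there is `p`, smooth on `(0,∞) × X × X` and nonnegative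
there, with `rbKernel t x = p(t, x, ·) dy` for every `t > 0` and every `x`.
[cite: ReyBelletThomas2002, Thm 2.1] -/
theorem rb_jointDensity_of_hormander (hH : Hormander1967_thm11) (hV2 : RBNondegenerate P.V) (hΛ : Λ ≠ 0) :
    ∃ p : ℝ → RBPhaseSpace N → RBPhaseSpace N → ℝ,
      ContDiffOn ℝ ∞ (fun w : ℝ × RBPhaseSpace N × RBPhaseSpace N => p w.1 w.2.1 w.2.2)
        (Set.Ioi (0 : ℝ) ×ˢ Set.univ) ∧
      (∀ t : ℝ, 0 < t → ∀ x y, 0 ≤ p t x y) ∧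
      ∀ t : ℝ≥0, 0 < t → ∀ x : RBPhaseSpace N,
        P.rbKernel Λ N T_L T_R t x =
          (volume : Measure (RBPhaseSpace N)).withDensity fun y => ENNReal.ofReal (p t x y) := by
  haveI := isAddHaarMeasure_volume_rbPhaseSpace N
  haveI : SFinite (volume : Measure (RBPhaseSpace N)) := inferInstance
  haveI : IsLocallyFiniteMeasure (volume : Measure (RBPhaseSpace N)) := inferInstance
  haveI : BorelSpace (RBPhaseSpace N × RBPhaseSpace N) := Prod.borelSpace
  haveI : MeasurableAdd (RBPhaseSpace N × RBPhaseSpace N) := inferInstance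
  haveI : (volume : Measure (RBPhaseSpace N × RBPhaseSpace N)).IsAddHaarMeasure :=
    Measure.prod.instIsAddHaarMeasure _ _
  haveI : SFinite (volume : Measure (RBPhaseSpace N × RBPhaseSpace N)) := by
    change SFinite ((volume : Measure (RBPhaseSpace N)).prod (volume : Measure (RBPhaseSpace N)))
    infer_instance
  haveI : BorelSpace (ℝ × (RBPhaseSpace N × RBPhaseSpace N)) := Prod.borelSpace
  haveI : MeasurableAdd (ℝ × (RBPhaseSpace N × RBPhaseSpace N)) := inferInstance
  haveI : (volume : Measure (ℝ × (RBPhaseSpace N × RBPhaseSpace N))).IsAddHaarMeasure :=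
    Measure.prod.instIsAddHaarMeasure _ _
  -- the facts about the constructed semigroup, then make it opaque
  have hann := fun (φ : ℝ × (RBPhaseSpace N × RBPhaseSpace N) → ℝ) (hφ : ContDiff ℝ ∞ φ)
    (hφc : HasCompactSupport φ) (hφ0 : tsupport φ ⊆ Set.Ioi (0 : ℝ) ×ˢ Set.univ) =>
    rb_jointLaw_annihilated hU hV hk₁ hk₂ hγ.le Λ hL.le hR.le (T_L := T_L) (T_R := T_R) hφ hφc hφ0
  have hlaw := fun (Θ : ℝ × (RBPhaseSpace N × RBPhaseSpace N) → ℝ) (hΘ : Continuous Θ)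
    (hΘc : HasCompactSupport Θ) =>
    integral_jointLaw_eq hU hV hk₁ hk₂ hγ.le Λ hL.le hR.le (T_L := T_L) (T_R := T_R) hΘ hΘc
  have hcts := fun (c : RBPhaseSpace N → ℝ) (hc : ContDiff ℝ ∞ c) (hcc : HasCompactSupport c) =>
    continuous_act_rbSemigroup_timeStart hU hV hk₁ hk₂ hγ Λ hL hR (T_L := T_L) (T_R := T_R) hc hcc
  set S := P.rbSemigroup hU hV hk₁ hk₂ hγ.le Λ N T_L T_R hL.le hR.le with hS
  have hSk : ∀ t, S.kernel t = P.rbKernel Λ N T_L T_R t := fun t => rfl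
  haveI : IsLocallyFiniteMeasure S.jointLaw := S.isLocallyFiniteMeasure_jointLaw
  clear_value S
  have hγL : 0 < P.γ * T_L := mul_pos hγ hL
  have hγR : 0 < P.γ * T_R := mul_pos hγ hR
  -- the family and its hypoellipticity
  set Z₀ := P.rbDoubledFamily Λ N T_L T_R none with hZ₀
  set Zs : Fin 2 ⊕ Fin 2 → ℝ × (RBPhaseSpace N × RBPhaseSpace N) → ℝ × (RBPhaseSpace N × RBPhaseSpace N) :=
    fun j => P.rbDoubledFamily Λ N T_L T_R (some j) with hZs
  have hfam : (fun o : Option (Fin 2 ⊕ Fin 2) => o.elim Z₀ Zs) = P.rbDoubledFamily Λ N T_L T_R := by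
    funext o; cases o <;> rfl
  have hZ₀s : ContDiff ℝ ∞ Z₀ := P.contDiff_rbDoubledFamily hU.1 hV.1 Λ N T_L T_R none
  have hZss : ∀ j, ContDiff ℝ ∞ (Zs j) := fun j => P.contDiff_rbDoubledFamily hU.1 hV.1 Λ N T_L T_R (some j)
  have hbr : IsBracketGenerating (fun o : Option (Fin 2 ⊕ Fin 2) => o.elim Z₀ Zs)
      ((⊤ : Opens (ℝ × (RBPhaseSpace N × RBPhaseSpace N))) : Set (ℝ × (RBPhaseSpace N × RBPhaseSpace N))) := by
    rw [hfam, Opens.coe_top]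
    exact P.isBracketGenerating_rbDoubledFamily hU.1 hV.1 hV2 hΛ hγL hγR
  have hyp := hH (ℝ × (RBPhaseSpace N × RBPhaseSpace N)) volume (Fin 2 ⊕ Fin 2) ⊤ Z₀ Zs (fun _ => 2 * P.γ)
    hZ₀s hZss contDiff_const hbr
  -- the joint law solves `P̃ m = 0` on `U = (0,∞) × X × X`
  set U : Set (ℝ × (RBPhaseSpace N × RBPhaseSpace N)) := Set.Ioi (0 : ℝ) ×ˢ Set.univ with hUdef
  have hUo : IsOpen U := isOpen_Ioi.prod isOpen_univ
  have himg : Literature.Analysis.Distribution.ImageIsSmoothOn (measureDistribution S.jointLaw ⊤)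
      (hormanderTranspose Z₀ Zs fun _ => 2 * P.γ) volume U := by
    refine ⟨0, contDiffOn_const, fun φ ψ hφU hψ => ?_⟩
    rw [measureDistribution_apply]
    simp only [Pi.zero_apply, zero_mul, integral_zero]
    have : (fun w => ψ w) = hormanderTranspose Z₀ Zs (fun _ => 2 * P.γ) φ := hψ
    rw [this]
    exact hann φ φ.contDiff φ.hasCompactSupport hφU
  obtain ⟨g, hg, hgint⟩ := hyp (measureDistribution S.jointLaw ⊤) U hUo (subset_univ _) himg
  refine ⟨fun t x y => g (t, (x, y)), hg, ?_⟩
  have hgc : ContinuousOn g U := hg.continuousOn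
  -- the slices `y ↦ g(t, x, y)` are continuous for `t > 0`
  have hslice_cont : ∀ t : ℝ, 0 < t → ∀ x : RBPhaseSpace N, Continuous fun y => g (t, (x, y)) := fun t ht x =>
    hgc.comp_continuous (continuous_const.prodMk (continuous_const.prodMk continuous_id))
      fun y => ⟨ht, mem_univ _⟩
  -- testing against `ψ(t, x) c(y)`: `P_t c(x) = ∫ g(t,x,y) c(y) dy` on `(0,∞) × X`
  have hkey : ∀ {c : RBPhaseSpace N → ℝ}, ContDiff ℝ ∞ c → HasCompactSupport c →
      ∀ t : ℝ, 0 < t → ∀ x : RBPhaseSpace N, S.act t.toNNReal c x = ∫ y, g (t, (x, y)) * c y := by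
    intro c hc hcc
    set U₂ : Set (ℝ × RBPhaseSpace N) := Set.Ioi (0 : ℝ) ×ˢ Set.univ with hU₂
    have hU₂o : IsOpen U₂ := isOpen_Ioi.prod isOpen_univ
    set Fc : ℝ × RBPhaseSpace N → ℝ := fun q => S.act q.1.toNNReal c q.2 with hFc
    set Gc : ℝ × RBPhaseSpace N → ℝ := fun q => ∫ y, g (q.1, (q.2, y)) * c y with hGc
    have hFcc : Continuous Fc := hcts c hc hcc
    have hci : Integrable c volume := hc.continuous.integrable_of_hasCompactSupport hcc
    -- `Gc` is continuous on `U₂` (locally uniform bound of `g` and dominated convergence)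
    have hGcc : ContinuousOn Gc U₂ := by
      rintro ⟨t₀, x₀⟩ ⟨ht₀, -⟩
      have ht₀' : (0 : ℝ) < t₀ := ht₀
      have hK : IsCompact (Icc (t₀ / 2) (t₀ + 1) ×ˢ (closedBall x₀ 1 ×ˢ tsupport c)) :=
        isCompact_Icc.prod ((isCompact_closedBall x₀ 1).prod hcc)
      have hKU : Icc (t₀ / 2) (t₀ + 1) ×ˢ (closedBall x₀ 1 ×ˢ tsupport c) ⊆ U := fun w hw =>
        ⟨lt_of_lt_of_le (by linarith) hw.1.1, mem_univ _⟩
      obtain ⟨M, hM⟩ := hK.exists_bound_of_continuousOn (hgc.mono hKU)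
      refine (continuousAt_of_dominated (bound := fun y => max M 0 * ‖c y‖) ?_ ?_ (hci.norm.const_mul _) ?_).continuousWithinAt
      · have hnb : Ioi (0 : ℝ) ×ˢ (univ : Set (RBPhaseSpace N)) ∈ 𝓝 ((t₀, x₀) : ℝ × RBPhaseSpace N) :=
          hU₂o.mem_nhds ⟨ht₀, mem_univ _⟩
        filter_upwards [hnb] with q hq
        exact ((hslice_cont q.1 hq.1 q.2).mul hc.continuous).aestronglyMeasurable
      · have hnb : Ioo (t₀ / 2) (t₀ + 1) ×ˢ ball x₀ 1 ∈ 𝓝 ((t₀, x₀) : ℝ × RBPhaseSpace N) :=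
          prod_mem_nhds (Ioo_mem_nhds (by linarith) (by linarith)) (ball_mem_nhds x₀ one_pos)
        filter_upwards [hnb] with q hq
        refine Eventually.of_forall fun y => ?_
        rw [norm_mul]
        by_cases hy : y ∈ tsupport c
        · exact mul_le_mul_of_nonneg_right ((hM (q.1, (q.2, y)) ⟨⟨hq.1.1.le, hq.1.2.le⟩,
            mem_closedBall.2 (le_of_lt (mem_ball.1 hq.2)), hy⟩).trans (le_max_left _ _)) (norm_nonneg _)
        · rw [image_eq_zero_of_notMem_tsupport hy, norm_zero, mul_zero, mul_zero]
      · refine Eventually.of_forall fun y => ?_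
        have hga : ContinuousAt g (t₀, (x₀, y)) := hgc.continuousAt (hUo.mem_nhds ⟨ht₀, mem_univ _⟩)
        exact ((ContinuousAt.comp (f := fun q : ℝ × RBPhaseSpace N => ((q.1, (q.2, y)) : ℝ × (RBPhaseSpace N × RBPhaseSpace N)))
          (x := (t₀, x₀)) hga ((continuous_fst.prodMk (continuous_snd.prodMk continuous_const)).continuousAt)).mul
          continuousAt_const)
    -- testing against `ψ(t, x) c(y)`
    have htest : ∀ ψ : ℝ × RBPhaseSpace N → ℝ, ContDiff ℝ ∞ ψ → HasCompactSupport ψ → tsupport ψ ⊆ U₂ →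
        ∫ q, ψ q • (Fc q - Gc q) = 0 := by
      intro ψ hψ hψc hψU
      set φ : ℝ × (RBPhaseSpace N × RBPhaseSpace N) → ℝ := fun w => ψ (w.1, w.2.1) * c w.2.2 with hφ
      have hπ : Continuous fun w : ℝ × (RBPhaseSpace N × RBPhaseSpace N) => ((w.1, w.2.1) : ℝ × RBPhaseSpace N) :=
        continuous_fst.prodMk (continuous_fst.comp continuous_snd)
      have hφs : ContDiff ℝ ∞ φ :=
        (hψ.comp (contDiff_fst.prodMk (contDiff_fst.comp contDiff_snd))).mul (hc.comp (contDiff_snd.comp contDiff_snd))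
      have hsupp : tsupport φ ⊆ (fun w => (w.1, w.2.1)) ⁻¹' tsupport ψ ∩ (fun w => w.2.2) ⁻¹' tsupport c := by
        refine closure_minimal (fun w hw => ?_) (((isClosed_tsupport _).preimage hπ).inter
          ((isClosed_tsupport _).preimage (continuous_snd.comp continuous_snd)))
        have h := Function.mem_support.1 hw
        exact ⟨subset_tsupport _ (Function.mem_support.2 (left_ne_zero_of_mul h)),
          subset_tsupport _ (Function.mem_support.2 (right_ne_zero_of_mul h))⟩
      have hφc : HasCompactSupport φ := by
        -- `tsupport φ` lies in the image of the compact `tsupport ψ × tsupport c` under the homeomorphism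
        have hK : IsCompact ((fun r : (ℝ × RBPhaseSpace N) × RBPhaseSpace N => ((r.1.1, (r.1.2, r.2)) :
            ℝ × (RBPhaseSpace N × RBPhaseSpace N))) '' (tsupport ψ ×ˢ tsupport c)) :=
          (hψc.isCompact.prod hcc.isCompact).image
            ((continuous_fst.comp continuous_fst).prodMk ((continuous_snd.comp continuous_fst).prodMk continuous_snd))
        refine IsCompact.of_isClosed_subset hK (isClosed_tsupport _) fun w hw => ?_
        obtain ⟨h1, h2⟩ := hsupp hw
        exact ⟨((w.1, w.2.1), w.2.2), ⟨h1, h2⟩, rfl⟩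
      have hφU : tsupport φ ⊆ U := fun w hw => ⟨(hψU (hsupp hw).1).1, mem_univ _⟩
      let Φ : 𝓓((⊤ : Opens (ℝ × (RBPhaseSpace N × RBPhaseSpace N))), ℝ) := ⟨φ, hφs, hφc, fun _ _ => trivial⟩
      have hΦ := hgint Φ hφU
      rw [measureDistribution_apply] at hΦ
      -- left side: `∫ φ dm = ∫ ψ · F_c` over `(0,∞) × X`
      have hleft : ∫ w, (Φ : ℝ × (RBPhaseSpace N × RBPhaseSpace N) → ℝ) w ∂S.jointLaw = ∫ q, ψ q * Fc q := by
        change ∫ w, φ w ∂S.jointLaw = _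
        rw [hlaw φ hφs.continuous hφc, MarkovSemigroupFor.baseMeasure_eq]
        have hinner : ∀ q : ℝ × RBPhaseSpace N,
            ∫ y, φ (q.1, (q.2, y)) ∂(P.rbKernel Λ N T_L T_R q.1.toNNReal q.2) = ψ q * Fc q := by
          intro q
          simp only [hφ, hFc, MarkovSemigroupFor.act_apply, hSk]
          exact integral_const_mul (ψ (q.1, q.2)) c
        simp_rw [hinner]
        refine setIntegral_eq_integral_of_forall_compl_eq_zero fun q hq => ?_
        have hψ0 : ψ q = 0 := image_eq_zero_of_notMem_tsupport fun h => hq (hψU h)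
        rw [hψ0, zero_mul]
      -- right side: `∫ g φ dvol = ∫ ψ · G_c`
      have hgφc : Continuous fun w => g w * φ w := by
        refine continuous_iff_continuousAt.2 fun w => ?_
        by_cases hw : w ∈ U
        · exact (hgc.continuousAt (hUo.mem_nhds hw)).mul hφs.continuous.continuousAt
        · have hw' : w ∉ tsupport φ := fun h => hw (hφU h)
          have h0 : (fun w => g w * φ w) =ᶠ[𝓝 w] fun _ => 0 := by
            filter_upwards [(isClosed_tsupport φ).isOpen_compl.mem_nhds hw'] with r hr
            rw [image_eq_zero_of_notMem_tsupport hr, mul_zero]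
          exact h0.continuousAt
      have hgφi : Integrable (fun w => g w * φ w) (volume : Measure (ℝ × (RBPhaseSpace N × RBPhaseSpace N))) :=
        hgφc.integrable_of_hasCompactSupport (show HasCompactSupport (g * φ) from hφc.mul_left)
      have hright : ∫ w, g w * (Φ : ℝ × (RBPhaseSpace N × RBPhaseSpace N) → ℝ) w
          ∂(volume : Measure (ℝ × (RBPhaseSpace N × RBPhaseSpace N))) = ∫ q, ψ q * Gc q := by
        change ∫ w, g w * φ w ∂(volume : Measure (ℝ × (RBPhaseSpace N × RBPhaseSpace N))) = _
        -- reassociate `ℝ × (X × X) ≃ (ℝ × X) × X` and integrate in `y` first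
        have hmp := (volume_preserving_prodAssoc (α₁ := ℝ) (β₁ := RBPhaseSpace N) (γ₁ := RBPhaseSpace N))
        rw [← hmp.integral_comp (MeasurableEquiv.prodAssoc).measurableEmbedding]
        have hgi' : Integrable (fun r : (ℝ × RBPhaseSpace N) × RBPhaseSpace N =>
            g (MeasurableEquiv.prodAssoc r) * φ (MeasurableEquiv.prodAssoc r))
            ((volume : Measure (ℝ × RBPhaseSpace N)).prod (volume : Measure (RBPhaseSpace N))) :=
          hmp.integrable_comp_emb (MeasurableEquiv.prodAssoc).measurableEmbedding |>.2 hgφi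
        rw [show (volume : Measure ((ℝ × RBPhaseSpace N) × RBPhaseSpace N)) =
            (volume : Measure (ℝ × RBPhaseSpace N)).prod volume from rfl, integral_prod _ hgi']
        refine integral_congr_ae (Eventually.of_forall fun q => ?_)
        simp only [hφ, hGc, MeasurableEquiv.prodAssoc, MeasurableEquiv.coe_mk, Equiv.prodAssoc_apply]
        rw [← integral_const_mul]
        refine integral_congr_ae (Eventually.of_forall fun y => ?_)
        ring
      have heq : ∫ q, ψ q * Fc q = ∫ q, ψ q * Gc q := by rw [← hleft, ← hright]; exact hΦ
      -- conclude (integrability of both products: continuous with compact support on `U₂`)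
      have hψcont := hψ.continuous
      have hFi : Integrable (fun q => ψ q * Fc q) := (hψcont.mul hFcc).integrable_of_hasCompactSupport hψc.mul_right
      have hGi : Integrable (fun q => ψ q * Gc q) := by
        have hcont : Continuous fun q => ψ q * Gc q := by
          refine continuous_iff_continuousAt.2 fun q => ?_
          by_cases hq : q ∈ U₂
          · exact hψcont.continuousAt.mul (hGcc.continuousAt (hU₂o.mem_nhds hq))
          · have hq' : q ∉ tsupport ψ := fun h => hq (hψU h)
            have h0 : (fun q => ψ q * Gc q) =ᶠ[𝓝 q] fun _ => 0 := by
              filter_upwards [(isClosed_tsupport ψ).isOpen_compl.mem_nhds hq'] with r hr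
              rw [image_eq_zero_of_notMem_tsupport hr, zero_mul]
            exact h0.continuousAt
        exact hcont.integrable_of_hasCompactSupport hψc.mul_right
      simp only [smul_eq_mul, mul_sub]
      rw [integral_sub hFi hGi, heq, sub_self]
    -- a.e. on `U₂`, then everywhere on `U₂` by continuity
    have hloc : LocallyIntegrableOn (fun q => Fc q - Gc q) U₂ volume :=
      (hFcc.continuousOn.sub hGcc).locallyIntegrableOn hU₂o.measurableSet
    have hae := hU₂o.ae_eq_zero_of_integral_contDiff_smul_eq_zero hloc htest
    have hae' : Fc =ᵐ[volume.restrict U₂] Gc :=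
      (ae_restrict_iff' hU₂o.measurableSet).2 (hae.mono fun q hq hqU => sub_eq_zero.1 (hq hqU))
    have hEq : EqOn Fc Gc U₂ := Measure.eqOn_open_of_ae_eq hae' hU₂o hFcc.continuousOn hGcc
    intro t ht x
    exact hEq (show ((t, x) : ℝ × RBPhaseSpace N) ∈ U₂ from ⟨ht, mem_univ _⟩)
  -- every kernel `P_t(x, ·)`, `t > 0`, has the density `g(t, x, ·) ≥ 0`
  have hboth : ∀ t : ℝ, 0 < t → ∀ x : RBPhaseSpace N, (∀ y, 0 ≤ g (t, (x, y))) ∧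
      S.kernel t.toNNReal x = (volume : Measure (RBPhaseSpace N)).withDensity
        fun y => ENNReal.ofReal (g (t, (x, y))) := fun t ht x =>
    eq_withDensity_of_forall_integral_eq (m := S.kernel t.toNNReal x) volume (hslice_cont t ht x)
      fun b hb hbc => hkey hb hbc t ht x
  refine ⟨fun t ht x y => (hboth t ht x).1 y, fun t ht x => ?_⟩
  have h := (hboth t (by exact_mod_cast ht) x).2
  rw [Real.toNNReal_coe] at h
  show P.rbKernel Λ N T_L T_R t x =
    (volume : Measure (RBPhaseSpace N)).withDensity fun y => ENNReal.ofReal (g (t, (x, y)))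
  rw [← hSk t]
  exact h

end Density

end OscillatorChain

end Literature.MathematicalPhysics.KineticTheory.HeatConduction
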